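import Summits.CriticalPhenomena.Ising3DConformalLimit.Theorems.IsingEuclidUpgradeR4NonGaussianDefs
import Summits.CriticalPhenomena.Ising3DConformalLimit.Theorems.LatticeSDPCertificatesWindowGivesDoubling
import Summits.CriticalPhenomena.Ising3DConformalLimit.Theorems.LatticeSDPCertificatesWindowGivesTopHeavyBubble
import Literature.Probability.LatticeModels.PointwiseScalingLimitEtaExists
import Literature.Probability.LatticeModels.HighDimPointwiseTriviality
import Literature.Probability.LatticeModels.CriticalCorrWellDefined
import HarnessLib

/-!
# Crux `WindowForcesU4` (stmt-CriticalPhenomena-5505), line `registered`: stub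
# `stub_windowLatticeMomentRatio` — WINDOW ⇒ lattice moment ratio `M₁²/M₂ ≥ c(y)` (ADC21 Lemma 4.4)

`G = criticalTwoPoint 3`; WINDOW is `c (n/m)^{-(3/2-ε)} G(m e₁) ≤ G(n e₁)` (`1 ≤ m ≤ n`). For an
injective shape `y`, a dilation `L ≥ 1` and the region `A = Λ_L + 3DL e₁` (`D = maxᵢ ‖yᵢ‖_∞ ≥ 1`),
all source/region and source/source differences have sup norm in `[L, 5DL]` (§C); the MMS sandwich,
axial monotonicity and WINDOW between the scales `L ≤ 15DL` give `ℓ g ≤ G ≤ g`, `g = G(Le₁)` (§D);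
hence `M₁ ≥ |A| ℓ⁴g²`, each term of `M₂` is `≤ (2g/ℓ)² G(v-w)²`, and the top-heavy bubble (item 5509)
at `R = 2L` gives `M₁²/M₂ ≥ ℓ¹⁰|A|/(32CL³) ≥ ℓ¹⁰/(32C)` in infinite volume; the free-box moments
converge termwise and `A ⊆ Λ_n` eventually (§A, §E). §A–§B are adapted from the landed per-limit
template `Theorems/IsingEuclidUpgradeR4NonGaussianMomentRatioLowerBound` (crux 0636).

References: M. Aizenman, H. Duminil-Copin, Ann. Math. 194 (2021) = arXiv:1912.07973, §4.2 Lemma 4.4,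
App. A Prop. A.3; A. Messager, S. Miracle-Solé, J. Stat. Phys. 17 (1977).
-/

noncomputable section

open Filter Topology Set Function MeasureTheory Finset
open Literature.Probability.LatticeModels Literature.Probability.Percolation
open Summit.CriticalPhenomena.Ising3DConformalLimit.Theses.LatticeSDPCertificates
  (WindowBelowHalf WindowGivesDoubling WindowGivesTopHeavyBubble)
open Summit.CriticalPhenomena.Ising3DConformalLimit.Cruxes.IsingEuclidUpgradeR4NonGaussian.FreeCovarianceDeltaDichotomy
  (boxMoment₁ boxMoment₂ boxG threePointRatio twoStep)

namespace Summit.CriticalPhenomena.Ising3DConformalLimit.LatticeSDPCertificatesWindowForcesU4.WindowLatticeMomentRatioProof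

/-! ## A. Infinite-volume dictionary
(adapted from `Theorems/IsingEuclidUpgradeR4NonGaussianMomentRatioLowerBound`, §A) -/

/-- `0 < ⟨σ_aσ_b⟩_{β_c}` on `ℤ³` (Simon–Lieb lower bound off the diagonal, `= 1` on it). [folklore] -/
private theorem criticalCorr_pair_pos (a b : Site 3) : 0 < criticalCorr 3 2 ![a, b] := by
  -- adapted from IsingEuclidUpgradeR4NonGaussianMomentRatioLowerBound (criticalCorr_pair_pos)
  rw [criticalCorr_two_pair]
  by_cases hu : b - a = 0
  · rw [hu, criticalTwoPoint_zero']; exact one_pos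
  · obtain ⟨c, C, hc, h⟩ := criticalTwoPoint_bounds_holds (d := 3) le_rfl
    have hn : 0 < ‖b - a‖ := norm_pos_iff.2 hu
    exact lt_of_lt_of_le (mul_pos hc (Real.rpow_pos_of_pos hn _)) (h _ hu).1

/-- The free box two-point function converges to the critical pair correlator. [folklore] -/
private theorem tendsto_boxG (u v : Site 3) :
    Tendsto (fun L => boxG L u v) atTop (𝓝 (criticalCorr 3 2 ![u, v])) := by
  -- adapted from IsingEuclidUpgradeR4NonGaussianMomentRatioLowerBound (tendsto_boxG)
  have hmem : (BoundaryCondition.free : BoundaryCondition (Site 3)) ∈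
      ({.free, .plus, .minus} : Set (BoundaryCondition (Site 3))) := by simp
  have h := criticalCorr_wellDefined_holds (d := 3) le_rfl 2 ![u, v] .free hmem
  refine Tendsto.congr (fun L => ?_) h
  simp only [boxG, isingTwoPoint, spinMonomial_two]

/-- `L → ∞` limit of the first moment (`G` = the critical pair correlator; the three-point ratios
converge termwise). [folklore] -/
private theorem tendsto_boxMoment₁ {G : Site 3 → Site 3 → ℝ}
    (hG : ∀ u v, G u v = criticalCorr 3 2 ![u, v]) (a b c e : Site 3) (A : Finset (Site 3)) :
    Tendsto (fun L => boxMoment₁ L a b c e A) atTop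
      (𝓝 (∑ v ∈ A, (G a v * G v b / G a b) * (G c v * G v e / G c e))) := by
  obtain rfl : G = fun u v => criticalCorr 3 2 ![u, v] := funext fun u => funext fun v => hG u v
  have h3 : ∀ a b v : Site 3, Tendsto (fun L => threePointRatio L a b v) atTop
      (𝓝 (criticalCorr 3 2 ![a, v] * criticalCorr 3 2 ![v, b] / criticalCorr 3 2 ![a, b])) :=
    fun a b v => ((tendsto_boxG a v).mul (tendsto_boxG v b)).div (tendsto_boxG a b)
      (criticalCorr_pair_pos a b).ne'
  exact tendsto_finsetSum A fun v _ => (h3 a b v).mul (h3 c e v)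

/-- `L → ∞` limit of the second moment (`G` = the critical pair correlator; the two-step kernels
divided by the pair correlator converge termwise). [folklore] -/
private theorem tendsto_boxMoment₂ {G : Site 3 → Site 3 → ℝ}
    (hG : ∀ u v, G u v = criticalCorr 3 2 ![u, v]) (a b c e : Site 3) (A : Finset (Site 3)) :
    Tendsto (fun L => boxMoment₂ L a b c e A) atTop
      (𝓝 (∑ v ∈ A, ∑ w ∈ A,
        ((G a v * G v w * G w b + G a w * G w v * G v b) / G a b) *
        ((G c v * G v w * G w e + G c w * G w v * G v e) / G c e))) := by
  obtain rfl : G = fun u v => criticalCorr 3 2 ![u, v] := funext fun u => funext fun v => hG u v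
  have h2 : ∀ a b v w : Site 3, Tendsto (fun L => twoStep L a b v w / boxG L a b) atTop
      (𝓝 ((criticalCorr 3 2 ![a, v] * criticalCorr 3 2 ![v, w] * criticalCorr 3 2 ![w, b] +
        criticalCorr 3 2 ![a, w] * criticalCorr 3 2 ![w, v] * criticalCorr 3 2 ![v, b]) /
        criticalCorr 3 2 ![a, b])) := fun a b v w =>
    ((((tendsto_boxG a v).mul (tendsto_boxG v w)).mul (tendsto_boxG w b)).add
      (((tendsto_boxG a w).mul (tendsto_boxG w v)).mul (tendsto_boxG v b))).div (tendsto_boxG a b)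
      (criticalCorr_pair_pos a b).ne'
  exact tendsto_finsetSum A fun v _ => tendsto_finsetSum A fun w _ => (h2 a b v w).mul (h2 c e v w)

/-! ## B. Elementary real arithmetic (adapted from the same template, §B) -/

/-- Lower bound for a three-point ratio `pq/s` from `ℓ ≤ rp`, `ℓ ≤ rq`, `rs ≤ U`. [folklore] -/
private theorem ratio_lower {r ℓ U p q s : ℝ} (hr : 0 < r) (hℓ : 0 < ℓ) (hp : ℓ ≤ r * p)
    (hq : ℓ ≤ r * q) (hs : 0 < s) (hsU : r * s ≤ U) : ℓ ^ 2 / (U * r) ≤ p * q / s := by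
  -- adapted from IsingEuclidUpgradeR4NonGaussianMomentRatioLowerBound (ratio_lower)
  have hU : 0 < U := lt_of_lt_of_le (mul_pos hr hs) hsU
  rw [div_le_div_iff₀ (mul_pos hU hr) hs]
  have h1 : ℓ * ℓ ≤ (r * p) * (r * q) := mul_le_mul hp hq hℓ.le ((hℓ.le).trans hp)
  nlinarith [mul_le_mul_of_nonneg_left hsU (mul_nonneg (mul_nonneg hr.le hs.le) hℓ.le)]

/-- Upper bound for a two-step term `(p g q + p' g q')/s` from `rp, rq, rp', rq' ≤ U`, `ℓ ≤ rs`.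
[folklore] -/
private theorem twoStep_upper {r ℓ U p q p' q' g s : ℝ} (hr : 0 < r) (hℓ : 0 < ℓ) (hp0 : 0 ≤ p)
    (hq0 : 0 ≤ q) (hp0' : 0 ≤ p') (hq0' : 0 ≤ q') (hg : 0 ≤ g) (hp : r * p ≤ U) (hq : r * q ≤ U)
    (hp' : r * p' ≤ U) (hq' : r * q' ≤ U) (hs : ℓ ≤ r * s) :
    (p * g * q + p' * g * q') / s ≤ 2 * U ^ 2 / (ℓ * r) * g := by
  -- adapted (shortened) from IsingEuclidUpgradeR4NonGaussianMomentRatioLowerBound (twoStep_upper)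
  have hs0 : 0 < s := by
    by_contra h
    push Not at h
    have : r * s ≤ 0 := mul_nonpos_of_nonneg_of_nonpos hr.le h
    linarith
  have hU : 0 ≤ U := le_trans (mul_nonneg hr.le hp0) hp
  have h1 : (r * p) * (r * q) ≤ U * U := mul_le_mul hp hq (mul_nonneg hr.le hq0) hU
  have h2 : (r * p') * (r * q') ≤ U * U := mul_le_mul hp' hq' (mul_nonneg hr.le hq0') hU
  rw [div_mul_eq_mul_div, div_le_div_iff₀ hs0 (mul_pos hℓ hr)]
  nlinarith [mul_le_mul_of_nonneg_right hs (mul_nonneg (mul_nonneg hp0 hq0) hg),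
    mul_le_mul_of_nonneg_right hs (mul_nonneg (mul_nonneg hp0' hq0') hg),
    mul_le_mul_of_nonneg_left h1 (mul_nonneg hs0.le hg),
    mul_le_mul_of_nonneg_left h2 (mul_nonneg hs0.le hg)]

/-! ## C. Sup-norm geometry of the dilated sources and the counting region -/

/-- `‖L • z‖_∞ = L ‖z‖_∞` for the dilation by `L ∈ ℕ` (as an integer scalar). [folklore] -/
private theorem supNorm_natCast_zsmul (L : ℕ) (z : Site 3) :
    Site.supNorm ((L : ℤ) • z) = L * Site.supNorm z := by
  rw [natCast_zsmul]
  exact le_antisymm (Site.supNorm_nsmul_le L z) (Site.mul_supNorm_le_supNorm_nsmul L z)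

/-- `‖a - b‖_∞ ≤ ‖a‖_∞ + ‖b‖_∞`. [folklore] -/
private theorem supNorm_sub_le (a b : Site 3) :
    Site.supNorm (a - b) ≤ Site.supNorm a + Site.supNorm b := by
  rw [sub_eq_add_neg, ← Site.supNorm_neg b]
  exact Site.supNorm_add_le a (-b)

/-- Region geometry: for `‖u‖_∞ ≤ L`, `‖z‖_∞ = 3D`, `‖y‖_∞ ≤ D`, `D ≥ 1`, the site `u + L(z - y)`
has sup norm in `[L, 5DL]`. [folklore] -/
private theorem region_geometry {D L : ℕ} (hD : 1 ≤ D) {u z y : Site 3}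
    (hu : Site.supNorm u ≤ L) (hz : Site.supNorm z = 3 * D) (hy : Site.supNorm y ≤ D) :
    L ≤ Site.supNorm (u + (L : ℤ) • (z - y)) ∧
      Site.supNorm (u + (L : ℤ) • (z - y)) ≤ 5 * (L * D) := by
  have hw : Site.supNorm ((L : ℤ) • (z - y)) = L * Site.supNorm (z - y) :=
    supNorm_natCast_zsmul L _
  have hzlo : 2 * D ≤ Site.supNorm (z - y) := by
    have h := Site.supNorm_le_supNorm_sub_add z y; omega
  have hzhi : Site.supNorm (z - y) ≤ 4 * D := by have h := supNorm_sub_le z y; omega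
  have h1 := Site.supNorm_add_le u ((L : ℤ) • (z - y))
  have h2 := Site.supNorm_le_supNorm_sub_add ((L : ℤ) • (z - y)) (-u)
  rw [sub_neg_eq_add, add_comm _ u, Site.supNorm_neg] at h2
  constructor <;> nlinarith

/-- Source geometry: two distinct points of sup norm `≤ D`, dilated by `L`, are at sup distance in
`[L, 5DL]`. [folklore] -/
private theorem source_geometry {D L : ℕ} {y y' : Site 3} (hne : y ≠ y')
    (hy : Site.supNorm y ≤ D) (hy' : Site.supNorm y' ≤ D) :
    L ≤ Site.supNorm ((L : ℤ) • y' - (L : ℤ) • y) ∧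
      Site.supNorm ((L : ℤ) • y' - (L : ℤ) • y) ≤ 5 * (L * D) := by
  rw [← smul_sub, supNorm_natCast_zsmul]
  have h1 : 1 ≤ Site.supNorm (y' - y) := by
    rw [Nat.one_le_iff_ne_zero]
    exact fun h => hne (sub_eq_zero.1 (Site.supNorm_eq_zero_iff.1 h)).symm
  have h2 : Site.supNorm (y' - y) ≤ 2 * D := by have := supNorm_sub_le y' y; omega
  exact ⟨Nat.le_mul_of_pos_right L h1, by nlinarith⟩

/-! ## D. The lattice pair window from WINDOW -/

/-- WINDOW + the Messager–Miracle-Solé sphere sandwich + axial monotonicity: for `D, L ≥ 1` and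
`L ≤ ‖u‖_∞ ≤ 5DL`, `ℓ ≤ G(u)/G(L e₁) ≤ 1` with `ℓ = c (15D)^{-(3/2-ε)}` (WINDOW between the scales
`L` and `15DL`). [cite: MessagerMiracleSoleJSP1977, Theorem (monotonicity)] -/
private theorem window_pair {ε c : ℝ}
    (hwin : ∀ m n : ℕ, 1 ≤ m → m ≤ n →
      c * ((n : ℝ) / m) ^ (-((3:ℝ) / 2 - ε)) * criticalTwoPoint 3 (Pi.single 0 (m : ℤ)) ≤
        criticalTwoPoint 3 (Pi.single 0 (n : ℤ)))
    {D L : ℕ} (hD : 1 ≤ D) (hL : 1 ≤ L) {u : Site 3} (hlo : L ≤ Site.supNorm u)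
    (hhi : Site.supNorm u ≤ 5 * (L * D)) :
    c * ((15 * D : ℕ) : ℝ) ^ (-((3:ℝ) / 2 - ε)) ≤
        (criticalTwoPoint 3 (Pi.single 0 (L : ℤ)))⁻¹ * criticalTwoPoint 3 u ∧
      (criticalTwoPoint 3 (Pi.single 0 (L : ℤ)))⁻¹ * criticalTwoPoint 3 u ≤ 1 := by
  have hg := criticalTwoPoint_axis_pos L
  have hu1 : 1 ≤ Site.supNorm u := hL.trans hlo
  obtain ⟨hsl, hsu⟩ := criticalTwoPoint_axis_sandwich hu1
  rw [le_inv_mul_iff₀ hg, inv_mul_le_iff₀ hg, mul_one, mul_comm]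
  refine ⟨?_, hsu.trans (criticalTwoPoint_axis_antitone hlo)⟩
  have hW := hwin L (15 * D * L) hL (Nat.le_mul_of_pos_left L (by omega))
  have hq : ((15 * D * L : ℕ) : ℝ) / (L : ℝ) = ((15 * D : ℕ) : ℝ) := by
    have hL0 : (L : ℝ) ≠ 0 := by exact_mod_cast (by omega : L ≠ 0)
    push_cast
    field_simp
  rw [hq] at hW
  exact hW.trans ((criticalTwoPoint_axis_antitone (by nlinarith [hhi])).trans hsl)

/-! ## E. The registered stub -/

/-- **Registered stub `stub_windowLatticeMomentRatio`** (analytic half of ADC21 Lemma 4.4 ON THE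
LATTICE). Under WINDOW, for every injective shape `y` there is `c = c(y) > 0` such that for all
dilations `L ≥ 1` the counting region `A = Λ_L + 3DL e₁` (`D = maxᵢ ‖yᵢ‖_∞`) has box moment ratio
`M₁²/M₂ ≥ c` eventually in the box size `n`: the pair window (`window_pair`) at all source/region
pairs, the top-heavy bubble (`windowGivesTopHeavyBubble_proof`, item 5509) at `R = 2L`, and
`Λ_n ↑ ℤ³` termwise. [cite: AizenmanDuminilCopinAnnals2021, §4.2 Lemma 4.4] -/
theorem stub_windowLatticeMomentRatio :
    WindowBelowHalf → ∀ y : Fin 4 → Site 3, Function.Injective y →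
      ∃ c : ℝ, 0 < c ∧ ∀ᶠ L : ℕ in atTop, ∃ A : Finset (Site 3), ∀ᶠ n : ℕ in atTop,
        A ⊆ box 3 n ∧
          c ≤ boxMoment₁ n ((L : ℤ) • y 0) ((L : ℤ) • y 1) ((L : ℤ) • y 2) ((L : ℤ) • y 3) A ^ 2 /
                boxMoment₂ n ((L : ℤ) • y 0) ((L : ℤ) • y 1) ((L : ℤ) • y 2) ((L : ℤ) • y 3) A := by
  classical
  intro hW y hy
  -- ① the bubble constant (item 5509), WINDOW's constants, the pair correlator
  obtain ⟨C₀, hC₀⟩ := Theorems.windowGivesTopHeavyBubble_proof hW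
  obtain ⟨ε, cW, _hε, hcW, hwin⟩ := hW
  set G : Site 3 → Site 3 → ℝ := fun u v => criticalCorr 3 2 ![u, v] with hGdef
  have hG : ∀ u v, G u v = criticalCorr 3 2 ![u, v] := fun u v => rfl
  have hGp : ∀ u v : Site 3, 0 < G u v := fun u v => criticalCorr_pair_pos u v
  have hG0 : ∀ u v : Site 3, 0 ≤ G u v := fun u v => (hGp u v).le
  -- ② the size `D` of the shape and the constants `C, ℓ, κ`
  set D : ℕ := Finset.univ.sup fun i => Site.supNorm (y i) with hD
  have hyD : ∀ i, Site.supNorm (y i) ≤ D := fun i =>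
    Finset.le_sup (f := fun i => Site.supNorm (y i)) (Finset.mem_univ i)
  have hD1 : 1 ≤ D := by
    by_contra h
    have h0 : ∀ i, y i = 0 := fun i =>
      Site.supNorm_eq_zero_iff.1 (Nat.eq_zero_of_le_zero ((hyD i).trans (by omega)))
    exact hy.ne (show (0 : Fin 4) ≠ 1 by decide) ((h0 0).trans (h0 1).symm)
  set C : ℝ := max C₀ 1 with hCdef
  have hCpos : 0 < C := one_pos.trans_le (le_max_right _ _)
  have hD0 : (0:ℝ) < ((15 * D : ℕ) : ℝ) := by exact_mod_cast (by omega : 0 < 15 * D)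
  set ℓ : ℝ := cW * ((15 * D : ℕ) : ℝ) ^ (-((3:ℝ) / 2 - ε)) with hℓ
  have hℓpos : 0 < ℓ := mul_pos hcW (Real.rpow_pos_of_pos hD0 _)
  set κ : ℝ := ℓ ^ 10 / (64 * C) with hκ
  have hκpos : 0 < κ := by positivity
  set z₀ : Site 3 := Pi.single 0 ((3 * D : ℕ) : ℤ) with hz₀
  have hz₀n : Site.supNorm z₀ = 3 * D := by
    simp [hz₀, Site.supNorm, Fin.univ_succ, Pi.single_apply, Int.natAbs_mul]
  refine ⟨κ, hκpos, Filter.eventually_atTop.2 ⟨1, fun L hL => ?_⟩⟩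
  -- ③ the counting region `A = Λ_L + L z₀` at dilation `L`
  set p : Site 3 := (L : ℤ) • z₀ with hp
  set A : Finset (Site 3) := (box 3 L).image (fun u => u + p) with hA
  refine ⟨A, ?_⟩
  have hcardA : #A = (2 * L + 1) ^ 3 := by
    rw [hA, Finset.card_image_of_injective _ (add_left_injective p), card_box]
  have hAne : A.Nonempty := Finset.card_pos.1 (by rw [hcardA]; positivity)
  have hAcard : (L:ℝ) ^ 3 ≤ #A := by
    rw [hcardA]; push_cast
    exact pow_le_pow_left₀ (by positivity) (by linarith only [(Nat.cast_nonneg L : (0:ℝ) ≤ L)]) 3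
  -- ④ the scale `g = G(L e₁)`, the normalisation `r = 1/g`, the pair windows
  have hgpos : 0 < criticalTwoPoint 3 (Pi.single 0 (L : ℤ)) := criticalTwoPoint_axis_pos L
  set g : ℝ := criticalTwoPoint 3 (Pi.single 0 (L : ℤ)) with hgdef
  set r : ℝ := g⁻¹ with hr
  have hrpos : 0 < r := inv_pos.2 hgpos
  have hGxv : ∀ i : Fin 4, ∀ v ∈ A,
      ℓ ≤ r * G ((L : ℤ) • y i) v ∧ r * G ((L : ℤ) • y i) v ≤ 1 := by
    intro i v hv
    obtain ⟨u, hu, rfl⟩ := Finset.mem_image.1 hv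
    have hgeo := region_geometry (L := L) hD1 (mem_box_iff_supNorm_le.1 hu) hz₀n (hyD i)
    have heq : u + p - (L : ℤ) • y i = u + (L : ℤ) • (z₀ - y i) := by rw [hp, smul_sub]; abel
    rw [hG, criticalCorr_two_pair, heq]
    exact window_pair hwin hD1 hL hgeo.1 hgeo.2
  have hGvx : ∀ i : Fin 4, ∀ v ∈ A,
      ℓ ≤ r * G v ((L : ℤ) • y i) ∧ r * G v ((L : ℤ) • y i) ≤ 1 := by
    intro i v hv
    have hsymm : G v ((L : ℤ) • y i) = G ((L : ℤ) • y i) v := criticalCorr_two_pair_comm _ _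
    rw [hsymm]; exact hGxv i v hv
  have hGsrc : ∀ i j : Fin 4, i ≠ j →
      ℓ ≤ r * G ((L : ℤ) • y i) ((L : ℤ) • y j) ∧ r * G ((L : ℤ) • y i) ((L : ℤ) • y j) ≤ 1 := by
    intro i j hij
    have hgeo := source_geometry (L := L) (hy.ne hij) (hyD i) (hyD j)
    rw [hG, criticalCorr_two_pair]
    exact window_pair hwin hD1 hL hgeo.1 hgeo.2
  set a : Site 3 := (L : ℤ) • y 0
  set b : Site 3 := (L : ℤ) • y 1
  set c : Site 3 := (L : ℤ) • y 2
  set e : Site 3 := (L : ℤ) • y 3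
  have hGab : ℓ ≤ r * G a b ∧ r * G a b ≤ 1 := hGsrc 0 1 (by decide)
  have hGce : ℓ ≤ r * G c e ∧ r * G c e ≤ 1 := hGsrc 2 3 (by decide)
  -- ⑤ the bubble at scale `2L` (item 5509 and `G(2Le₁) ≤ g = 1/r`)
  have hbubble : ∑ t ∈ box 3 (2 * L), criticalTwoPoint 3 t ^ 2 ≤
      8 * C * (L:ℝ) ^ 3 * (1 / r) ^ 2 := by
    have h2 : criticalTwoPoint 3 (Pi.single 0 ((2 * L : ℕ) : ℤ)) ≤ g :=
      criticalTwoPoint_axis_antitone (show L ≤ 2 * L by omega)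
    have h3 : criticalTwoPoint 3 (Pi.single 0 ((2 * L : ℕ) : ℤ)) ^ 2 ≤ g ^ 2 :=
      pow_le_pow_left₀ (criticalTwoPoint_nonneg' _) h2 2
    have h4 : 1 / r = g := by rw [hr, one_div, inv_inv]
    rw [h4]
    calc ∑ t ∈ box 3 (2 * L), criticalTwoPoint 3 t ^ 2
        ≤ C₀ * ((2 * L : ℕ) : ℝ) ^ 3 * criticalTwoPoint 3 (Pi.single 0 ((2 * L : ℕ) : ℤ)) ^ 2 :=
          hC₀ (2 * L) (by omega)
      _ ≤ C * ((2 * L : ℕ) : ℝ) ^ 3 * g ^ 2 :=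
          mul_le_mul (mul_le_mul_of_nonneg_right (le_max_left _ _) (by positivity)) h3
            (sq_nonneg _) (by positivity)
      _ = 8 * C * (L:ℝ) ^ 3 * g ^ 2 := by push_cast; ring
  -- the inner sums of `M₂` are bubbles at scale `2L`
  have hinner : ∀ v ∈ A, ∑ w ∈ A, criticalTwoPoint 3 (w - v) ^ 2 ≤
      ∑ t ∈ box 3 (2 * L), criticalTwoPoint 3 t ^ 2 := by
    intro v hv
    calc ∑ w ∈ A, criticalTwoPoint 3 (w - v) ^ 2
        = ∑ t ∈ A.image (fun w => w - v), criticalTwoPoint 3 t ^ 2 := by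
          rw [Finset.sum_image fun _ _ _ _ h => sub_left_injective h]
      _ ≤ ∑ t ∈ box 3 (2 * L), criticalTwoPoint 3 t ^ 2 := by
          refine Finset.sum_le_sum_of_subset_of_nonneg ?_ fun t _ _ => sq_nonneg _
          refine Finset.image_subset_iff.2 fun w hw => ?_
          obtain ⟨u, hu, rfl⟩ := Finset.mem_image.1 hv
          obtain ⟨u', hu', rfl⟩ := Finset.mem_image.1 hw
          rw [add_sub_add_right_eq_sub]
          rw [mem_box] at hu hu' ⊢
          intro j
          obtain ⟨hu1, hu2⟩ := hu j
          obtain ⟨hu1', hu2'⟩ := hu' j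
          simp only [Pi.sub_apply]
          push_cast
          omega
  -- ⑥ the moments in infinite volume: `M₁ ≥ |A| τ²`, `M₂ ≤ σ² |A| · 8 C L³ / r²`, `M₂ > 0`
  set M₁ : ℝ := ∑ v ∈ A, (G a v * G v b / G a b) * (G c v * G v e / G c e) with hM₁
  set M₂ : ℝ := ∑ v ∈ A, ∑ w ∈ A,
    ((G a v * G v w * G w b + G a w * G w v * G v b) / G a b) *
    ((G c v * G v w * G w e + G c w * G w v * G v e) / G c e) with hM₂
  set τ : ℝ := ℓ ^ 2 / (1 * r) with hτ
  have hτ0 : 0 ≤ τ := by positivity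
  have hM₁lo : (#A : ℝ) * τ ^ 2 ≤ M₁ := by
    rw [hM₁, ← nsmul_eq_mul, ← Finset.sum_const]
    refine Finset.sum_le_sum fun v hv => ?_
    rw [pow_two]
    refine mul_le_mul ?_ ?_ hτ0 ?_
    · exact ratio_lower hrpos hℓpos (hGxv 0 v hv).1 (hGvx 1 v hv).1 (hGp _ _) hGab.2
    · exact ratio_lower hrpos hℓpos (hGxv 2 v hv).1 (hGvx 3 v hv).1 (hGp _ _) hGce.2
    · exact div_nonneg (mul_nonneg (hG0 _ _) (hG0 _ _)) (hG0 _ _)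
  set σ : ℝ := 2 * (1:ℝ) ^ 2 / (ℓ * r) with hσ
  have hσ0 : 0 ≤ σ := by positivity
  have hterm : ∀ v ∈ A, ∀ w ∈ A,
      ((G a v * G v w * G w b + G a w * G w v * G v b) / G a b) *
        ((G c v * G v w * G w e + G c w * G w v * G v e) / G c e)
        ≤ σ ^ 2 * criticalTwoPoint 3 (w - v) ^ 2 := by
    -- adapted from IsingEuclidUpgradeR4NonGaussianMomentRatioLowerBound (hterm)
    intro v hv w hw
    have hvw : G v w = criticalTwoPoint 3 (w - v) := criticalCorr_two_pair v w
    have hwv : G w v = criticalTwoPoint 3 (w - v) :=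
      (criticalCorr_two_pair_comm w v).trans (criticalCorr_two_pair v w)
    rw [hvw, hwv]
    have hg0 : 0 ≤ criticalTwoPoint 3 (w - v) := criticalTwoPoint_nonneg' _
    have hab' := twoStep_upper hrpos hℓpos (hG0 _ _) (hG0 _ _) (hG0 _ _) (hG0 _ _) hg0
      (hGxv 0 v hv).2 (hGvx 1 w hw).2 (hGxv 0 w hw).2 (hGvx 1 v hv).2 hGab.1
    have hce' := twoStep_upper hrpos hℓpos (hG0 _ _) (hG0 _ _) (hG0 _ _) (hG0 _ _) hg0
      (hGxv 2 v hv).2 (hGvx 3 w hw).2 (hGxv 2 w hw).2 (hGvx 3 v hv).2 hGce.1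
    calc _ ≤ (σ * criticalTwoPoint 3 (w - v)) * (σ * criticalTwoPoint 3 (w - v)) :=
          mul_le_mul hab' hce' (div_nonneg (add_nonneg (mul_nonneg (mul_nonneg (hG0 _ _) hg0) (hG0 _ _))
            (mul_nonneg (mul_nonneg (hG0 _ _) hg0) (hG0 _ _))) (hG0 _ _)) (mul_nonneg hσ0 hg0)
      _ = σ ^ 2 * criticalTwoPoint 3 (w - v) ^ 2 := by ring
  have hM₂hi : M₂ ≤ σ ^ 2 * ((#A : ℝ) * (8 * C * (L:ℝ) ^ 3 * (1 / r) ^ 2)) := by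
    calc M₂ ≤ ∑ v ∈ A, ∑ w ∈ A, σ ^ 2 * criticalTwoPoint 3 (w - v) ^ 2 :=
          Finset.sum_le_sum fun v hv => Finset.sum_le_sum fun w hw => hterm v hv w hw
      _ = σ ^ 2 * ∑ v ∈ A, ∑ w ∈ A, criticalTwoPoint 3 (w - v) ^ 2 := by
          rw [Finset.mul_sum]
          refine Finset.sum_congr rfl fun v _ => ?_
          rw [Finset.mul_sum]
      _ ≤ σ ^ 2 * ∑ _v ∈ A, 8 * C * (L:ℝ) ^ 3 * (1 / r) ^ 2 := by
          refine mul_le_mul_of_nonneg_left (Finset.sum_le_sum fun v hv => ?_) (sq_nonneg _)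
          exact (hinner v hv).trans hbubble
      _ = σ ^ 2 * ((#A : ℝ) * (8 * C * (L:ℝ) ^ 3 * (1 / r) ^ 2)) := by
          rw [Finset.sum_const, nsmul_eq_mul]
  have hM₂pos : 0 < M₂ := by
    refine Finset.sum_pos (fun v _ => Finset.sum_pos (fun w _ => ?_) hAne) hAne
    refine mul_pos (div_pos (add_pos ?_ ?_) (hGp _ _)) (div_pos (add_pos ?_ ?_) (hGp _ _)) <;>
      exact mul_pos (mul_pos (hGp _ _) (hGp _ _)) (hGp _ _)
  -- ⑦ the ratio: `2κ M₂ ≤ M₁²`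
  have hkey : 2 * κ * M₂ ≤ M₁ ^ 2 := by
    calc 2 * κ * M₂ ≤ 2 * κ * (σ ^ 2 * ((#A : ℝ) * (8 * C * (L:ℝ) ^ 3 * (1 / r) ^ 2))) :=
          mul_le_mul_of_nonneg_left hM₂hi (by positivity)
      _ = (ℓ ^ 8 / r ^ 4) * #A * (L:ℝ) ^ 3 := by
          rw [hκ, hσ]
          field_simp
          ring
      _ ≤ (ℓ ^ 8 / r ^ 4) * #A * #A := mul_le_mul_of_nonneg_left hAcard (by positivity)
      _ = ((#A : ℝ) * τ ^ 2) ^ 2 := by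
          rw [hτ]
          field_simp
      _ ≤ M₁ ^ 2 := pow_le_pow_left₀ (by positivity) hM₁lo 2
  have hratio : κ < M₁ ^ 2 / M₂ := by
    rw [lt_div_iff₀ hM₂pos]
    linarith only [hkey, mul_pos hκpos hM₂pos]
  -- ⑧ `Λ_n ↑ ℤ³`: termwise box limits and `A ⊆ Λ_n` eventually
  have hT := ((tendsto_boxMoment₁ hG a b c e A).pow 2).div (tendsto_boxMoment₂ hG a b c e A)
    hM₂pos.ne'
  filter_upwards [hT.eventually_const_lt hratio, eventually_subset_box' A] with n hn hAn
  exact ⟨hAn, hn.le⟩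

end Summit.CriticalPhenomena.Ising3DConformalLimit.LatticeSDPCertificatesWindowForcesU4.WindowLatticeMomentRatioProof

end
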